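import Literature.MathematicalPhysics.QuantumFieldTheory.Balaban1983to89.B8Prop6CubeMemberScalarGammaHolds
import Literature.MathematicalPhysics.QuantumFieldTheory.Balaban1983to89.B8Ineq159FlatCubeMemberTransplantL3
import Literature.MathematicalPhysics.QuantumFieldTheory.Balaban1983to89.B8Prop6CubeMemberScalarGammaOfGBoundG

/-!
# `Balaban1983to89.B8Prop6CubeMemberScalarGammaHoldsG` — [Balaban1985RegularSpaces] PROPOSITION 6 (p. 99), (1.135)–(1.138), AT EVERY CUBE OF PRINT'S BIG-BLOCK
# SUB-LATTICE — UNCONDITIONAL — **WITH A `G`-VALUED GAUGE TRANSFORMATION** ([Balaban1985Averaging] p. 20 «We consider a Lie subgroup G of a unitary group U(N)», `SU(N)` the example; [B8] p. 76 takes `R(U)X = UXU⁻¹ for a unitary matrix U`): the `G`-VALUED CROWN of this seat's γ chain,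
# `gaugedBoundB8_cubeMember_scalar_γ_holds(_L3)_mem`, and the 3-line corollary back to NODE 00's `GaugedBoundB8`

statement-level skeleton of published theorems with citation tags; proofs where landed; nothing here is a claim about the Yang–Mills mass gap

T. Bałaban, *Spaces of regular gauge field configurations on a lattice and gauge fixing conditions*, Commun. Math. Phys. **99** (1985) 75–102
`[Balaban1985RegularSpaces]` ("B8"): Prop. 6 (1.134)–(1.138) p. 99, p. 98 (the cubes and the local axial gauge), Thm 4 p. 88, Prop. 3 p. 87, (1.58)–(1.62) pp. 86–87,
(1.31) p. 82, p. 76 («R(U)X = UXU⁻¹ for a unitary matrix U»); [Balaban1985Averaging] p. 20 («We consider a Lie subgroup G of a unitary group U(N)»); T. Bałaban, *Propagators for lattice gauge theories in a background field*, CMP **99** (1985) 389–434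
`[Balaban1985BackgroundPropagators]` ("[4]"): Thm 3.1 (3.47) p. 398, Thm 3.2 (3.48) p. 398, Thm 3.3 p. 399; T. Bałaban, *Propagators and renormalization transformations … II*,
CMP **96** (1984) 223–250 `[Balaban1984PropagatorsII]` (2.3) p. 224, Prop. 2.6 (2.136) p. 247.  STATUS: published, refereed.

CITATION HEADER (lean-in-tree rule).  Cell `pub-ymgap` (HUMAN RULING D-0062, Track A), DAG node N05 = [B8], seat `pub-ymgap-dag-n05-e` g33 (Prop-6 γ-crown authoring
lineage; g10–g12 typed `B8Prop6CubeMemberScalarGammaPrinted` ∕ `…OfIneq159Printed` ∕ `…Holds`), CROSS-CELL SERVICE for cell `ym3-torus` (LEAD-H ★ym-ust-19200-w5 g6, line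
H-P6J of crux stmt-QuantumFields-19200 «MinimiserStabilityRegPr», rung R3 = YM₃ on T³; pub-ymgap bus XCELL-1∕2, INTENT-G1): file (F8), the LAST of the `G`-valued re-run
`B8Thm4ExistsAtGammaG → B8Prop6CubeMemberFlat3GammaG → B8Eq191FlatLettersRDTau ∕ B8Prop5KLevelLettersG → B8Prop6CubeMemberFlatScalarGammaG → …GaugedRealGammaG →
…ScalarGammaG → …ScalarGammaOfGBoundG → THIS`, over ym3-torus's `G`-valued Theorem-4 driver (`B8Thm4SupportLocalBdryG`, p678402) and trace-free Proposition-5 bodies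
(`B8SockHFPTraceFree`, `B8SockHFP59GammaTraceFree` p678428).  WHAT IS REPRODUCED.  §1 ★ `gaugedBoundB8_cubeMember_scalar_γ_printed_mem` (twin of `…Printed` :72: the
named 𝒢-bound DISCHARGED by dag-n05-c's `gBoundCubeMemberPrinted_of_one_le`), §2 ★★ `gaugedBoundB8_cubeMember_scalar_γ_of_ineq159Printed_mem` (twin of `…OfIneq159Printed`
:71: the scalar γ clauses from the named flat fact `Ineq159FlatCubeMemberPrinted d L`), §3 ★★★ `gaugedBoundB8_cubeMember_scalar_γ_holds_mem` (`d ≥ 2`, odd `L ≥ 5`; twin of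
`…Holds` :61 over dag-n05-c's `ineq159FlatCubeMemberPrinted_holds`), §4 ★★★ `gaugedBoundB8_cubeMember_scalar_γ_holds_L3_mem` (`d ≥ 2`, odd `L ≥ 3`; twin of ym-inputs-p06's
`B8Prop6PrintedZdCubPGammaL3` §1 over `ineq159FlatCubeMemberPrinted_holds_L3`), §5 `gaugedBoundB8_of_body_mem` (the body with `u ∈ G ≤ U(𝔸)` ⇒ `Node00.GaugedBoundB8`,
3 lines).  The SU(N) instantiation (`𝔸 = M_N(ℂ)`, `G = SU(N)`, `H = SL(N, ℂ)`, `τ = tr`) is the companion `B8Prop6CubeMemberScalarGammaHoldsSU`.  THE `G`-CROWN: for a unital C⋆-algebra `𝔸`, a continuous tracial `τ : 𝔸 → ℂ`, subgroups `G ≤ H ≤ 𝔸ˣ` with `G` averaging-closed and unitary, (H2) `τ(log h) = 0`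
for `h ∈ H`, `‖h − 1‖ ≤ ⅛`, (H3) `e^S ∈ H` for `τ`-free `S`, and the closure `e^{iλ} ∈ G` for Hermitian `τ`-free `λ`: for every `η > 0`, every cube `c : CubeB8 d L K Ω` on
print's p. 98 sub-lattice above threshold and every `G`-VALUED `U₀ ∈ 𝔄_K({Ω_j}, α₀)` with `7dL²Mα₀ ≤ c₁`, THERE IS A `G`-VALUED GAUGE TRANSFORMATION `u` (and `v⁻¹u ∈ G` for
print's local axial gauge `v`) with (1.135)–(1.138) — `Node00.GaugedBoundB8`'s body.  At `𝔸 = M_N(ℂ)`, `G = SU(N)` (`N ≤ 25`: `B7AvgClosedSpecialUnitarySharp.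
avgClosed_specialUnitary_of_le`), `H = SL(N, ℂ)`, `τ = tr` (`B8SpecialUnitaryTrace`, `B8SpecialLinearTrace`): `u` special unitary.  Kind «kernel-checked proof», theorems only: no
`def`, no `… : Prop` fact, no `instance`, no `notation`, no existing module modified.  `--supports stmt-QuantumFields-19200` (ym3-torus's crux; count-neutral for both cells).

HONEST SCOPE.  By-name twins of landed theorems; the analytic inputs are exactly those of the unitary crown (dag-n05-c's transplant ∕ 𝒢-bound transfer ∕ parametrix, this
seat's flat line, lit-balaban's level-0 torus∕box readings) plus ym3-torus's trace-free re-runs of Proposition 5's bodies; NO new estimate; nothing of [B8]∕[4]∕[B6] asserted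
beyond those theorems; the J-SU data are PARAMETERS (inhabited at `M_N(ℂ)` by ym3-torus's files, not here).  N05's Track-A status (DISCHARGED OF RECORD, director-ym №237,
6∕28) is untouched and this is NOT a pub-ymgap discharge; rung R3 (YM₃ on T³) is ym3-torus's and NOT the Clay problem; nothing of `stub_halvingStep` ∕ crux 19200 is claimed
here; pub-ymgap = one finite 𝕋⁴ programme at fixed ε, Bałaban as printed; nothing continuum ∕ ℝ⁴ ∕ OS ∕ mass-gap ∕ Clay.  No `sorry`, no `def`.
-/

noncomputable section

namespace Literature.MathematicalPhysics.QuantumFieldTheory.Balaban1983to89.B8Prop6CubeMemberScalarGammaHoldsG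

open scoped Matrix
open NormedSpace
open scoped Matrix
open MatrixLog B7Prop1Explicit B7Prop2Explicit B7Prop1Local B7Eq92Concrete
open B7Prop4GeneralLevels (logCovIter linCovIter)
open B8Ineq132 (covDerivFwd InAk BondTouches)
open B8Eq140Level (SideTouches)
open B8Eq143PlaqExpansion (pdiv)
open B8Eq146AExpansion (iEta plaqCovDeriv)
open B8Eq155JBound (Jcur wsup)
open B8ScaledSupNorm (bondNorm msup)
open B8Eq138LandauZd (IsLandau138 covLap)
open B8Eq131CubesAdmissible (cubeFam)
open B8CubeMemberZd (cubeLamS cubeLamB)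
open B9SupplySockB9P3ZdBeta (CrossB)
open B8Thm32GBoundCubeMemberHolds (gBoundCubeMemberPrinted_of_one_le)
open B8Prop6CubeMemberScalarGammaOfGBoundG (gaugedBoundB8_cubeMember_scalar_γ_of_GBound_mem)
open B9SupplySockB9P3ZdGamma (cubeLamBP')
open Node00 (CubeB8 GaugedBoundB8)
open B7Prop1Explicit B7Prop2Explicit B7Prop1Local
open B8Ineq132 (InAk BondTouches)
open B8Ineq159FlatCubeMemberPrinted (cubeLamBP Ineq159FlatCubeMemberPrinted)
open B8Ineq159FlatCubeMemberSCGamma (sc4_cubeMember_of_ineq159Printed cubeLamBP_sub_splitIndex)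
open B8Ineq132 (InAk)
open B8Ineq159FlatCubeMemberTransplant (ineq159FlatCubeMemberPrinted_holds)
open B8Ineq159FlatCubeMemberTransplantL3 (ineq159FlatCubeMemberPrinted_holds_L3)
open MatrixLog B7Prop1Explicit B7Prop2Explicit B7Prop1Local B7Eq92Concrete
open B8Eq184Proof (gaugeExp cfgExp)
open B8Eq119TwistedAxial (Restr129)
open B8Eq138LandauZd (IsLandau138W logCfg covLap)
open B8Eq131Cubes (tLo tHi bLo bHi)
open B8Ineq130 (tlo thi)
open B8Eq140Level (SideTouches)
open B8Ineq132 (covDerivFwd)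
open B8Eq143PlaqExpansion (pdiv)
open B8Eq146AExpansion (iEta plaqCovDeriv)
open B8ScaledSupNorm (bondNorm msup)
open B7Prop4GeneralLevels (logCovIter)
open B8Eq115GaugeFixing (localGauge)
open B7Prop1Explicit (expUnit)
open B7Prop2Explicit (AvgClosed)
open MatrixLog (mlog)
open NormedSpace

export B7Prop1Explicit (Site)

variable {d : ℕ}

variable {𝔸 : Type} [CStarAlgebra 𝔸] [Nontrivial 𝔸]

/-! ## §1  From the two scalar γ clauses and the NAMED 𝒢-bound, the latter discharged (dag-n05-c `gBoundCubeMemberPrinted_of_one_le`) -/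

open Classical in
/-- ★ **[`G`-VALUED TWIN — gauge transformation `u ∈ G`, [Balaban1985Averaging] p. 20 «a Lie subgroup G of a unitary group U(N)»; joint J-SU parameters, `U₀ ∈ G`, conclusion = `Node00.GaugedBoundB8`'s body spelled out]** ★★ **PROPOSITION 6 (p. 99), (1.135)–(1.138) AT A CUBE OF PRINT'S BIG-BLOCK SUB-LATTICE FROM THE TWO SCALAR FLAT γ CLAUSES ALONE** — §2's
`gaugedBoundB8_cubeMember_scalar_γ_of_GBound` with its named hypothesis `GBoundCubeMemberPrinted (d − 1) (L − 1)` ([4] Theorem 3.2 (3.48) at `U = 1` on the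
cube member) DISCHARGED by dag-n05-c's kernel theorem `B8Thm32GBoundCubeMemberHolds.gBoundCubeMemberPrinted_of_one_le` (p567362) (exact transfer to lit-balaban's [B6] level-0 box
chain).  Per-cube hypotheses left: the SCALAR four-line γ (1.59) clause of Proposition 3's frame at the top truncation and the SCALAR two-line γ (1.59) clause of
Theorem 4's frame at every truncation (ℂ-valued bond functions, flat Landau gauge, collar and level-0 boundary allowances) — [B8] Prop. 3 ∕ Thm 4's (1.59) at
background `1` on the finite cube, [4] Thm 3.3-type, OPEN in the tree; print's p. 98 side conditions on the cube datum displayed.  UNCONDITIONAL theorem.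
[cite: Balaban1985RegularSpaces, Prop. 6 (1.135)–(1.138) p.99, p.98, Thm 4 p.88, Prop. 3 p.87, (1.59) p.86, (1.31) p.82, (1.91)–(1.92) p.91, (1.98) p.92, (1.101) p.93; Balaban1985BackgroundPropagators, Thm 3.2 (3.48) p.398, Thm 3.1 (3.47) p.398, Thm 3.3 p.399; Balaban1984PropagatorsII, Prop. 2.3 (2.87) p.238] -/
theorem gaugedBoundB8_cubeMember_scalar_γ_printed_mem (τ : 𝔸 →L[ℂ] ℂ) (hτ : ∀ x y : 𝔸, τ (x * y) = τ (y * x)) (hd2 : 2 ≤ d) {L : ℕ} (hL : 2 ≤ L)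
    {G H : Subgroup 𝔸ˣ} (hGrp2 : ∀ g ∈ H, ‖(g : 𝔸) - 1‖ ≤ 1 / 8 → τ (mlog (g : 𝔸)) = 0) (hGrp3 : ∀ S : 𝔸, τ S = 0 → expUnit S ∈ H)
    (hGA : AvgClosed d L G) (hGH : G ≤ H) (hGu : G ≤ unitaryUnits 𝔸)
    (hexpG : ∀ lam : Site d → 𝔸, (∀ x, IsSelfAdjoint (lam x)) → (∀ x, τ (lam x) = 0) → ∀ x, gaugeExp lam x ∈ G)
    {B₀ Bbd : ℝ} (hB₀ : 0 < B₀)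
    (hB : 2 ≤ 5 * (d : ℝ) * L * B₀) (hBbd : 0 ≤ Bbd) (hBd : 4 * Bbd ≤ ((d : ℝ) * L - 1) * B₀) :
    ∃ c₁ ρ₀ M₀ : ℝ, ∃ N₀ : ℕ, 0 < c₁ ∧ ∀ (η : ℝ), 0 < η → ∀ {K : ℕ} {Ω : ℕ → Set (Site d)} (c : CubeB8 d L K Ω),
      -- PRINT'S SIDE CONDITIONS (p. 98) on the cube datum, above threshold
      ∀ (Mh R : ℕ), 3 ≤ Mh → M₀ ≤ (L : ℝ) * Mh → Mh * L ∣ c.ρ → Mh * L ∣ c.M → R * (Mh * L) ≤ c.ρ → 2 * L ≤ R →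
        N₀ + 1 ≤ R * (L * Mh) → ρ₀ ≤ (c.ρ : ℝ) →
      -- THE SCALAR FLAT FOUR-LINE (1.59) CLAUSE OF PROPOSITION 3's FRAME at the cube's top truncation `c.k`: ℂ-valued bond functions in the
      -- flat Landau gauge on the collars of `{□_j}`, exterior-collar allowance on each line ([4] Thm 3.3 at `U = 1` for `G(1)`, `H(1)`, a priori)
      (∀ φ : Site d → Fin d → ℂ,
        IsLandau138 L c.k η (cubeFam false L c.a c.M c.ρ c.k 0) (cubeLamS L c.a c.M c.ρ c.k c.k) (1 : Site d → Fin d → ℂˣ) φ →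
        (∀ (y : Site d) (τ : Fin d), (∀ j, j ≤ c.k → ¬ SideTouches (cubeFam false L c.a c.M c.ρ c.k j) y τ) → φ y τ = 0) →
        msup L c.k η (-(1 : ℝ)) (fun j (b : Site d × Fin d) => SideTouches (cubeFam false L c.a c.M c.ρ c.k j) b.1 b.2) (fun b => φ b.1 b.2)
          ≤ B₀ * (bondNorm L c.k η (-(3 : ℝ)) (cubeFam false L c.a c.M c.ρ c.k) (fun x μ => Jcur η (1 : Site d → Fin d → ℂˣ) φ μ x)
            + wsup 1 (fun p : {p : ℕ × (Site d × Fin d) // p.1 ≤ c.k ∧ (p.2 ∈ cubeLamBP' L c.a c.M c.ρ c.k c.k p.1 ∨ (p.1 = 0 ∧ CrossB ((cubeFam false L c.a c.M c.ρ c.k) 0) p.2))} =>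
                linCovIter L (1 : Site d → Fin d → ℂˣ) (iEta η φ) p.1.1 p.1.2.1 p.1.2.2))
            + Bbd * msup L c.k η (-(1 : ℝ)) (fun j (b : Site d × Fin d) => j = 0 ∧ SideTouches (cubeFam false L c.a c.M c.ρ c.k 0) b.1 b.2 ∧
                ¬ BondTouches (cubeFam false L c.a c.M c.ρ c.k 0) b.1 b.2) (fun b => φ b.1 b.2) ∧
        msup L c.k η (-(2 : ℝ)) (fun j (t : Fin d × Fin d × Site d) => SideTouches (cubeFam false L c.a c.M c.ρ c.k j) t.2.2 t.2.1)
            (fun t => covDerivFwd η (1 : Site d → Fin d → ℂˣ) t.1 (fun z => φ z t.2.1) t.2.2)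
          ≤ B₀ * (bondNorm L c.k η (-(3 : ℝ)) (cubeFam false L c.a c.M c.ρ c.k) (fun x μ => Jcur η (1 : Site d → Fin d → ℂˣ) φ μ x)
            + wsup 1 (fun p : {p : ℕ × (Site d × Fin d) // p.1 ≤ c.k ∧ (p.2 ∈ cubeLamBP' L c.a c.M c.ρ c.k c.k p.1 ∨ (p.1 = 0 ∧ CrossB ((cubeFam false L c.a c.M c.ρ c.k) 0) p.2))} =>
                linCovIter L (1 : Site d → Fin d → ℂˣ) (iEta η φ) p.1.1 p.1.2.1 p.1.2.2))
            + Bbd * msup L c.k η (-(1 : ℝ)) (fun j (b : Site d × Fin d) => j = 0 ∧ SideTouches (cubeFam false L c.a c.M c.ρ c.k 0) b.1 b.2 ∧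
                ¬ BondTouches (cubeFam false L c.a c.M c.ρ c.k 0) b.1 b.2) (fun b => φ b.1 b.2) ∧
        bondNorm L c.k η (-(3 : ℝ)) (cubeFam false L c.a c.M c.ρ c.k) (fun x μ => pdiv η (1 : Site d → Fin d → ℂˣ) (plaqCovDeriv η (1 : Site d → Fin d → ℂˣ) φ) μ x)
          ≤ B₀ * (bondNorm L c.k η (-(3 : ℝ)) (cubeFam false L c.a c.M c.ρ c.k) (fun x μ => Jcur η (1 : Site d → Fin d → ℂˣ) φ μ x)
            + wsup 1 (fun p : {p : ℕ × (Site d × Fin d) // p.1 ≤ c.k ∧ (p.2 ∈ cubeLamBP' L c.a c.M c.ρ c.k c.k p.1 ∨ (p.1 = 0 ∧ CrossB ((cubeFam false L c.a c.M c.ρ c.k) 0) p.2))} =>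
                linCovIter L (1 : Site d → Fin d → ℂˣ) (iEta η φ) p.1.1 p.1.2.1 p.1.2.2))
            + Bbd * msup L c.k η (-(1 : ℝ)) (fun j (b : Site d × Fin d) => j = 0 ∧ SideTouches (cubeFam false L c.a c.M c.ρ c.k 0) b.1 b.2 ∧
                ¬ BondTouches (cubeFam false L c.a c.M c.ρ c.k 0) b.1 b.2) (fun b => φ b.1 b.2) ∧
        bondNorm L c.k η (-(3 : ℝ)) (cubeFam false L c.a c.M c.ρ c.k) (fun x μ => covLap η (1 : Site d → Fin d → ℂˣ) (fun z => φ z μ) x)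
          ≤ B₀ * (bondNorm L c.k η (-(3 : ℝ)) (cubeFam false L c.a c.M c.ρ c.k) (fun x μ => Jcur η (1 : Site d → Fin d → ℂˣ) φ μ x)
            + wsup 1 (fun p : {p : ℕ × (Site d × Fin d) // p.1 ≤ c.k ∧ (p.2 ∈ cubeLamBP' L c.a c.M c.ρ c.k c.k p.1 ∨ (p.1 = 0 ∧ CrossB ((cubeFam false L c.a c.M c.ρ c.k) 0) p.2))} =>
                linCovIter L (1 : Site d → Fin d → ℂˣ) (iEta η φ) p.1.1 p.1.2.1 p.1.2.2))
            + Bbd * msup L c.k η (-(1 : ℝ)) (fun j (b : Site d × Fin d) => j = 0 ∧ SideTouches (cubeFam false L c.a c.M c.ρ c.k 0) b.1 b.2 ∧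
                ¬ BondTouches (cubeFam false L c.a c.M c.ρ c.k 0) b.1 b.2) (fun b => φ b.1 b.2)) →
      ∀ (U₀ : Site d → Fin d → 𝔸ˣ), (∀ x κ, U₀ x κ ∈ G) → ∀ (α₀ : ℝ), 0 < α₀ → InAk L K η α₀ Ω U₀ →
      7 * d * (L : ℝ) ^ 2 * c.M * α₀ ≤ c₁ →
      -- THE SCALAR FLAT TWO-LINE (1.59) CLAUSE OF THEOREM 4's FRAME at every truncation `m ≤ c.k` (ℂ-valued, flat Landau gauge, collar allowance)
      (∀ m, 1 ≤ m → m ≤ c.k → ∀ φ : Site d → Fin d → ℂ,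
        IsLandau138 L m η ((cubeFam false L c.a c.M c.ρ c.k) 0) ((cubeLamS L c.a c.M c.ρ c.k) m) (1 : Site d → Fin d → ℂˣ) φ →
        (∀ (y : Site d) (τ : Fin d), (∀ j, j ≤ m → ¬ SideTouches ((cubeFam false L c.a c.M c.ρ c.k) j) y τ) → φ y τ = 0) →
        msup L m η (-(1 : ℝ)) (fun j (b : Site d × Fin d) => SideTouches ((cubeFam false L c.a c.M c.ρ c.k) j) b.1 b.2) (fun b => φ b.1 b.2)
          ≤ B₀ * (bondNorm L m η (-(3 : ℝ)) (cubeFam false L c.a c.M c.ρ c.k) (fun x μ => Jcur η (1 : Site d → Fin d → ℂˣ) φ μ x)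
            + wsup 1 (fun p : {p : ℕ × (Site d × Fin d) // p.1 ≤ m ∧ (p.2 ∈ (cubeLamBP' L c.a c.M c.ρ c.k) m p.1 ∨ (p.1 = 0 ∧ CrossB ((cubeFam false L c.a c.M c.ρ c.k) 0) p.2))} =>
                linCovIter L (1 : Site d → Fin d → ℂˣ) (iEta η φ) p.1.1 p.1.2.1 p.1.2.2))
            + Bbd * msup L m η (-(1 : ℝ)) (fun j (b : Site d × Fin d) => j = 0 ∧ SideTouches ((cubeFam false L c.a c.M c.ρ c.k) 0) b.1 b.2 ∧
                ¬ BondTouches ((cubeFam false L c.a c.M c.ρ c.k) 0) b.1 b.2) (fun b => φ b.1 b.2) ∧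
        msup L m η (-(2 : ℝ)) (fun j (t : Fin d × Fin d × Site d) => SideTouches ((cubeFam false L c.a c.M c.ρ c.k) j) t.2.2 t.2.1)
            (fun t => covDerivFwd η (1 : Site d → Fin d → ℂˣ) t.1 (fun z => φ z t.2.1) t.2.2)
          ≤ B₀ * (bondNorm L m η (-(3 : ℝ)) (cubeFam false L c.a c.M c.ρ c.k) (fun x μ => Jcur η (1 : Site d → Fin d → ℂˣ) φ μ x)
            + wsup 1 (fun p : {p : ℕ × (Site d × Fin d) // p.1 ≤ m ∧ (p.2 ∈ (cubeLamBP' L c.a c.M c.ρ c.k) m p.1 ∨ (p.1 = 0 ∧ CrossB ((cubeFam false L c.a c.M c.ρ c.k) 0) p.2))} =>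
                linCovIter L (1 : Site d → Fin d → ℂˣ) (iEta η φ) p.1.1 p.1.2.1 p.1.2.2))
            + Bbd * msup L m η (-(1 : ℝ)) (fun j (b : Site d × Fin d) => j = 0 ∧ SideTouches ((cubeFam false L c.a c.M c.ρ c.k) 0) b.1 b.2 ∧
                ¬ BondTouches ((cubeFam false L c.a c.M c.ρ c.k) 0) b.1 b.2) (fun b => φ b.1 b.2)) →
      ∃ u : Site d → 𝔸ˣ, (∀ x, u x ∈ G) ∧ (∀ x, x ∉ c.sq 0 → u x = 1) ∧
        Restr129 L c.k c.lamS (1 : Site d → Fin d → 𝔸ˣ) u ∧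
        IsLandau138W L c.k η (c.sq 0) c.lamS (1 : Site d → Fin d → 𝔸ˣ) (c.fixed U₀ u) ∧
        (∀ j, j ≤ c.k → ∀ b ∈ {b : Site d × Fin d | SideTouches (c.sq j) b.1 b.2},
          c.fixed U₀ u b.1 b.2 = cfgExp η (logCfg η (c.fixed U₀ u)) b.1 b.2 ∧ IsSelfAdjoint (logCfg η (c.fixed U₀ u) b.1 b.2) ∧
            ‖logCfg η (c.fixed U₀ u) b.1 b.2‖ ≤ (7 * d * (L : ℝ) ^ 2 * (5 * (d : ℝ) * L * B₀) * c.M * α₀) * ((L : ℝ) ^ j * η)⁻¹) ∧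
        (∀ x, ((c.vfix U₀)⁻¹ * u) x ∈ G) ∧
        AgreeOn (tlo L (tLo c.a c.ρ) c.k) (thi L (tHi c.a c.M c.ρ) c.k) (gaugeAct ((c.vfix U₀)⁻¹ * u)⁻¹ U₀) (c.fixed U₀ u) ∧
        msup L c.k η (-(2 : ℝ)) (fun j (t : Fin d × Fin d × Site d) => SideTouches (c.sq j) t.2.2 t.2.1)
            (fun t => covDerivFwd η (1 : Site d → Fin d → 𝔸ˣ) t.1 (fun z => c.expo η U₀ u z t.2.1) t.2.2) ≤ (7 * d * (L : ℝ) ^ 2 * (5 * (d : ℝ) * L * B₀) * c.M * α₀) ∧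
        bondNorm L c.k η (-(3 : ℝ)) c.sq
            (fun x μ => pdiv η (1 : Site d → Fin d → 𝔸ˣ) (plaqCovDeriv η (1 : Site d → Fin d → 𝔸ˣ) (c.expo η U₀ u)) μ x) ≤ (7 * d * (L : ℝ) ^ 2 * (5 * (d : ℝ) * L * B₀) * c.M * α₀) ∧
        bondNorm L c.k η (-(3 : ℝ)) c.sq (fun x μ => covLap η (1 : Site d → Fin d → 𝔸ˣ) (fun z => c.expo η U₀ u z μ) x) ≤ (7 * d * (L : ℝ) ^ 2 * (5 * (d : ℝ) * L * B₀) * c.M * α₀) ∧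
        (∀ (x : Site d) (μ : Fin d), bLo L c.a 0 0 ≤ x → x + e μ ≤ bHi L c.a c.M 0 0 →
          logCovIter L (1 : Site d → Fin d → 𝔸ˣ) (iEta η (c.expo η U₀ u)) c.k x μ = mlog ((avgIter L (c.axial U₀) c.k x μ : 𝔸ˣ) : 𝔸)) :=
  gaugedBoundB8_cubeMember_scalar_γ_of_GBound_mem (𝔸 := 𝔸) τ hτ hd2 hL hGrp2 hGrp3 hGA hGH hGu hexpG hB₀ hB hBbd hBd
    (gBoundCubeMemberPrinted_of_one_le (d - 1) (L - 1) (by omega))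

#print axioms gaugedBoundB8_cubeMember_scalar_γ_printed_mem

/-! ## §2  From the named flat fact `Ineq159FlatCubeMemberPrinted d L` -/

open Classical in
/-- ★★ **[`G`-VALUED TWIN — gauge transformation `u ∈ G`, [Balaban1985Averaging] p. 20 «a Lie subgroup G of a unitary group U(N)»; joint J-SU parameters, `U₀ ∈ G`, conclusion = `Node00.GaugedBoundB8`'s body spelled out]** ★★★ **PROPOSITION 6 (p. 99), (1.135)–(1.138) AT EVERY CUBE OF PRINT'S BIG-BLOCK SUB-LATTICE FROM THE ONE NAMED FLAT FACT `Ineq159FlatCubeMemberPrinted d L`.**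
There are `B₀ ≥ 1`, `c₁ > 0` and thresholds `ρ₀, M₀, N₀, R₀` (functions of `d, L` and the named fact's constants) such that for every `η > 0`, every cube
`c : CubeB8 d L K Ω` whose datum lies on print's p. 98 sub-lattice above threshold (`M_h = Lˢ ≥ 3`, `M₀ ≤ L^{s+1}`, `L^{s+1} ∣ ρ`, `L^{s+1} ∣ M`, `R·L^{s+1} ≤ ρ`,
`2L ≤ R`, `R₀ ≤ R`, `N₀ + 1 ≤ R·L^{s+1}`, `ρ₀ ≤ ρ`), every unitary `U₀ ∈ 𝔄_K({Ω_j}, α₀)` with `7dL²Mα₀ ≤ c₁`: `GaugedBoundB8 L η U₀ c (7dL²·5dLB₀·Mα₀)` —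
Proposition 6's gauge `u` on `□̃`, the Landau gauge (1.138) at background `1`, (1.136)₁–₄ with print's constant shape, (1.137).  HYPOTHESIS: the named fact
`h159` ((1.59) at `U₀ = 1` on the cube member over print's class = [4] Thm 3.3 at `U = 1`, Dirichlet exterior — OPEN); window `5 ≤ d·L`; the level-0
dictionary is dag-n05-w3's `mem_cubeLamBP_zero_iff_cubeLamBP'_or_crossB` (p588005) inside Fγ10a's `cubeLamBP_sub_splitIndex`.  Composition: Fγ10a `sc4_cubeMember_of_ineq159Printed` at the cube's datum with
the flat line's split index (SC4γ at `m = k`, the first two lines at every `1 ≤ m ≤ k`) into Fγ9 `gaugedBoundB8_cubeMember_scalar_γ_printed`.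
[cite: Balaban1985RegularSpaces, Prop. 6 (1.135)–(1.138) p.99, p.98, Thm 4 p.88, Prop. 3 p.87, (1.59) p.86, (1.62) p.87, (1.31) p.82; Balaban1985BackgroundPropagators, Thm 3.3 p.399, Thm 3.2 (3.48) p.398, Thm 3.1 (3.47) p.398; Balaban1984PropagatorsII, Prop. 2.6 (2.136) p.247, (2.3) p.224] -/
theorem gaugedBoundB8_cubeMember_scalar_γ_of_ineq159Printed_mem (τ : 𝔸 →L[ℂ] ℂ) (hτ : ∀ x y : 𝔸, τ (x * y) = τ (y * x)) (hd2 : 2 ≤ d) {L : ℕ} (hL : 2 ≤ L)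
    {G H : Subgroup 𝔸ˣ} (hGrp2 : ∀ g ∈ H, ‖(g : 𝔸) - 1‖ ≤ 1 / 8 → τ (mlog (g : 𝔸)) = 0) (hGrp3 : ∀ S : 𝔸, τ S = 0 → expUnit S ∈ H)
    (hGA : AvgClosed d L G) (hGH : G ≤ H) (hGu : G ≤ unitaryUnits 𝔸)
    (hexpG : ∀ lam : Site d → 𝔸, (∀ x, IsSelfAdjoint (lam x)) → (∀ x, τ (lam x) = 0) → ∀ x, gaugeExp lam x ∈ G)
    (hdL : 5 ≤ d * L)
    (h159 : Ineq159FlatCubeMemberPrinted d L) :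
    ∃ B₀ c₁ ρ₀ M₀ : ℝ, ∃ N₀ R₀ : ℕ, 1 ≤ B₀ ∧ 0 < c₁ ∧ ∀ (η : ℝ), 0 < η → ∀ {K : ℕ} {Ω : ℕ → Set (Site d)} (c : CubeB8 d L K Ω),
      -- PRINT'S SIDE CONDITIONS (p. 98) on the cube datum in the named fact's letters (`M_h = Lˢ`), above threshold
      ∀ (s R : ℕ), 3 ≤ L ^ s → M₀ ≤ (L : ℝ) ^ (s + 1) → L ^ (s + 1) ∣ c.ρ → L ^ (s + 1) ∣ c.M → R * L ^ (s + 1) ≤ c.ρ → 2 * L ≤ R →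
        R₀ ≤ R → N₀ + 1 ≤ R * L ^ (s + 1) → ρ₀ ≤ (c.ρ : ℝ) →
      ∀ (U₀ : Site d → Fin d → 𝔸ˣ), (∀ x κ, U₀ x κ ∈ G) → ∀ (α₀ : ℝ), 0 < α₀ → InAk L K η α₀ Ω U₀ →
      7 * d * (L : ℝ) ^ 2 * c.M * α₀ ≤ c₁ →
      ∃ u : Site d → 𝔸ˣ, (∀ x, u x ∈ G) ∧ (∀ x, x ∉ c.sq 0 → u x = 1) ∧
        Restr129 L c.k c.lamS (1 : Site d → Fin d → 𝔸ˣ) u ∧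
        IsLandau138W L c.k η (c.sq 0) c.lamS (1 : Site d → Fin d → 𝔸ˣ) (c.fixed U₀ u) ∧
        (∀ j, j ≤ c.k → ∀ b ∈ {b : Site d × Fin d | SideTouches (c.sq j) b.1 b.2},
          c.fixed U₀ u b.1 b.2 = cfgExp η (logCfg η (c.fixed U₀ u)) b.1 b.2 ∧ IsSelfAdjoint (logCfg η (c.fixed U₀ u) b.1 b.2) ∧
            ‖logCfg η (c.fixed U₀ u) b.1 b.2‖ ≤ (7 * d * (L : ℝ) ^ 2 * (5 * (d : ℝ) * L * B₀) * c.M * α₀) * ((L : ℝ) ^ j * η)⁻¹) ∧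
        (∀ x, ((c.vfix U₀)⁻¹ * u) x ∈ G) ∧
        AgreeOn (tlo L (tLo c.a c.ρ) c.k) (thi L (tHi c.a c.M c.ρ) c.k) (gaugeAct ((c.vfix U₀)⁻¹ * u)⁻¹ U₀) (c.fixed U₀ u) ∧
        msup L c.k η (-(2 : ℝ)) (fun j (t : Fin d × Fin d × Site d) => SideTouches (c.sq j) t.2.2 t.2.1)
            (fun t => covDerivFwd η (1 : Site d → Fin d → 𝔸ˣ) t.1 (fun z => c.expo η U₀ u z t.2.1) t.2.2) ≤ (7 * d * (L : ℝ) ^ 2 * (5 * (d : ℝ) * L * B₀) * c.M * α₀) ∧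
        bondNorm L c.k η (-(3 : ℝ)) c.sq
            (fun x μ => pdiv η (1 : Site d → Fin d → 𝔸ˣ) (plaqCovDeriv η (1 : Site d → Fin d → 𝔸ˣ) (c.expo η U₀ u)) μ x) ≤ (7 * d * (L : ℝ) ^ 2 * (5 * (d : ℝ) * L * B₀) * c.M * α₀) ∧
        bondNorm L c.k η (-(3 : ℝ)) c.sq (fun x μ => covLap η (1 : Site d → Fin d → 𝔸ˣ) (fun z => c.expo η U₀ u z μ) x) ≤ (7 * d * (L : ℝ) ^ 2 * (5 * (d : ℝ) * L * B₀) * c.M * α₀) ∧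
        (∀ (x : Site d) (μ : Fin d), bLo L c.a 0 0 ≤ x → x + e μ ≤ bHi L c.a c.M 0 0 →
          logCovIter L (1 : Site d → Fin d → 𝔸ˣ) (iEta η (c.expo η U₀ u)) c.k x μ = mlog ((avgIter L (c.axial U₀) c.k x μ : 𝔸ˣ) : 𝔸)) := by
  have hL1 : 1 ≤ L := le_trans (by norm_num) hL
  obtain ⟨B₀, ρ₀, M₀, N₀, R₀, hB₀, SC⟩ := sc4_cubeMember_of_ineq159Printed hd2 hL1 h159
  have hB₀pos : 0 < B₀ := lt_of_lt_of_le one_pos hB₀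
  have hdr : (2 : ℝ) ≤ d := by exact_mod_cast hd2
  have hLr : (2 : ℝ) ≤ L := by exact_mod_cast hL
  have hdLr : (5 : ℝ) ≤ (d : ℝ) * L := by exact_mod_cast hdL
  have hB : 2 ≤ 5 * (d : ℝ) * L * B₀ := by nlinarith [hB₀, hdr, hLr]
  have hBd : 4 * B₀ ≤ ((d : ℝ) * L - 1) * B₀ := by nlinarith [hB₀, hdLr]
  obtain ⟨c₁, ρ₁, M₁, N₁, hc₁, P6⟩ := gaugedBoundB8_cubeMember_scalar_γ_printed_mem (𝔸 := 𝔸) τ hτ hd2 hL hGrp2 hGrp3 hGA hGH hGu hexpG hB₀pos hB hB₀pos.le hBd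
  refine ⟨B₀, c₁, max ρ₀ ρ₁, max M₀ M₁, max N₀ N₁, R₀, hB₀, hc₁, ?_⟩
  intro η hη K Ω c s R hMh hM₀ hdρ hdM hRρ h2L hR₀ hN₀ hρ₀ U₀ hU₀ α₀ hα hA hs
  -- the cube's laws
  have hk : 1 ≤ c.k := c.one_le_k
  have hρL : L ≤ c.ρ := c.L_le_ρ
  -- print's side conditions in Fγ9's letters (`M_h := Lˢ`)
  have hMhL : L ^ s * L = L ^ (s + 1) := (pow_succ L s).symm
  have hLMh : L * L ^ s = L ^ (s + 1) := by rw [mul_comm]; exact hMhL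
  have hM₁ : M₁ ≤ (L : ℝ) * (L ^ s : ℕ) := by
    have : ((L : ℝ) * (L ^ s : ℕ)) = (L : ℝ) ^ (s + 1) := by push_cast; ring
    rw [this]; exact (le_max_right _ _).trans hM₀
  have hM₀' : M₀ ≤ (L : ℝ) ^ (s + 1) := (le_max_left _ _).trans hM₀
  have hN₁ : N₁ + 1 ≤ R * (L * L ^ s) := by rw [hLMh]; exact le_trans (Nat.succ_le_succ (le_max_right _ _)) hN₀
  have hN₀' : N₀ + 1 ≤ R * L ^ (s + 1) := le_trans (Nat.succ_le_succ (le_max_left _ _)) hN₀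
  have hρ₁ : ρ₁ ≤ (c.ρ : ℝ) := (le_max_right _ _).trans hρ₀
  have hρ₀' : ρ₀ ≤ (c.ρ : ℝ) := (le_max_left _ _).trans hρ₀
  -- the SCALAR γ clauses at this cube's datum from the named fact, in the flat line's split index
  have hI : ∀ m, 1 ≤ m → m ≤ c.k → ∀ j, j ≤ m → ∀ b ∈ cubeLamBP L c.a c.M c.ρ c.k m j,
      (b ∈ cubeLamBP' L c.a c.M c.ρ c.k m j ∨ (j = 0 ∧ CrossB (cubeFam false L c.a c.M c.ρ c.k 0) b)) :=
    fun m hm1 hmk => cubeLamBP_sub_splitIndex hL1 c.a c.M (hL1.trans hρL) hm1 hmk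
  have S := fun m (hm1 : 1 ≤ m) (hmk : m ≤ c.k) =>
    SC η hη c.a c.M c.ρ c.k s R hk hρL hM₀' hdρ hdM hRρ hR₀ hN₀' hρ₀' m hm1 hmk
      (fun j b => b ∈ cubeLamBP' L c.a c.M c.ρ c.k m j ∨ (j = 0 ∧ CrossB (cubeFam false L c.a c.M c.ρ c.k 0) b)) (hI m hm1 hmk)
  refine P6 η hη c (L ^ s) R hMh hM₁ (by rw [hMhL]; exact hdρ) (by rw [hMhL]; exact hdM) (by rw [hMhL]; exact hRρ) h2L hN₁ hρ₁
    (fun φ hLan hsupp => S c.k hk le_rfl φ hLan hsupp) U₀ hU₀ α₀ hα hA hs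
    (fun m hm1 hmk φ hLan hsupp => ⟨(S m hm1 hmk φ hLan hsupp).1, (S m hm1 hmk φ hLan hsupp).2.1⟩)

#print axioms gaugedBoundB8_cubeMember_scalar_γ_of_ineq159Printed_mem

/-! ## §3  ★★★ THE `G`-CROWN — `d ≥ 2`, odd `L ≥ 5` -/

open Classical in
/-- ★★★ **[`G`-VALUED CROWN — gauge transformation `u ∈ G`, [Balaban1985Averaging] p. 20 «a Lie subgroup G of a unitary group U(N)»; joint J-SU parameters, `U₀ ∈ G`, conclusion = `Node00.GaugedBoundB8`'s body spelled out; at `𝔸 = M_N(ℂ)`, `G = SU(N)` (`N ≤ 25`), `H = SL(N, ℂ)`, `τ = tr` this is Proposition 6 with `u` special unitary]** ★★★ **PROPOSITION 6 (p. 99), (1.135)–(1.138), AT EVERY CUBE OF PRINT'S BIG-BLOCK SUB-LATTICE — UNCONDITIONAL** (`d ≥ 2`, `L ≥ 5` odd).  There are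
`B₀ ≥ 1`, `c₁ > 0` and thresholds `ρ₀, M₀, N₀, R₀` (functions of `d, L`) such that for every `η > 0`, every cube `c : CubeB8 d L K Ω` whose datum lies on
print's p. 98 sub-lattice above threshold (`M_h = Lˢ ≥ 3`, `M₀ ≤ L^{s+1}`, `L^{s+1} ∣ ρ`, `L^{s+1} ∣ M`, `R·L^{s+1} ≤ ρ`, `2L ≤ R`, `R₀ ≤ R`, `N₀ + 1 ≤ R·L^{s+1}`,
`ρ₀ ≤ ρ`) and every unitary `U₀ ∈ 𝔄_K({Ω_j}, α₀)` with `7dL²Mα₀ ≤ c₁`: `GaugedBoundB8 L η U₀ c (7dL²·5dLB₀·Mα₀)` — «there exists a gauge transformation u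
defined on □̃ such that U₀^{u⁻¹} = U₁ = e^{iηA} on □̃ (1.135), Lʲη|A|, (Lʲη)²|∇^η A|, (Lʲη)³|∂^{η*}∂^η A|, (Lʲη)³|Δ^η A| ≤ 7dL²B₁Mα₀ on □_j (1.136), Q_k(ηA) =
(1∕i) log Ū₀′ᵏ on □^{(k)} (1.137)», in the Landau gauge (1.138) at background `1`.  PROOF: the crown `gaugedBoundB8_cubeMember_scalar_γ_of_ineq159Printed`
(p593169) at dag-n05-c's PROVED named fact `ineq159FlatCubeMemberPrinted_holds (d − 1) (L − 1)` (T4 transplant); `5 ≤ d·L` from `d ≥ 2`, `L ≥ 5`.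
[cite: Balaban1985RegularSpaces, Prop. 6 (1.135)–(1.138) p.99, p.98, Thm 4 p.88, Prop. 3 p.87, (1.59) p.86, (1.62) p.87, (1.31) p.82; Balaban1985BackgroundPropagators, Thm 3.3 p.399, Thm 3.2 (3.48) p.398, Thm 3.1 (3.47) p.398; Balaban1984PropagatorsII, Prop. 2.6 (2.136) p.247, (2.3) p.224] -/
theorem gaugedBoundB8_cubeMember_scalar_γ_holds_mem (τ : 𝔸 →L[ℂ] ℂ) (hτ : ∀ x y : 𝔸, τ (x * y) = τ (y * x)) (hd2 : 2 ≤ d) {L : ℕ} (hL5 : 5 ≤ L) (hodd : Odd L)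
    {G H : Subgroup 𝔸ˣ} (hGrp2 : ∀ g ∈ H, ‖(g : 𝔸) - 1‖ ≤ 1 / 8 → τ (mlog (g : 𝔸)) = 0) (hGrp3 : ∀ S : 𝔸, τ S = 0 → expUnit S ∈ H)
    (hGA : AvgClosed d L G) (hGH : G ≤ H) (hGu : G ≤ unitaryUnits 𝔸)
    (hexpG : ∀ lam : Site d → 𝔸, (∀ x, IsSelfAdjoint (lam x)) → (∀ x, τ (lam x) = 0) → ∀ x, gaugeExp lam x ∈ G) :
    ∃ B₀ c₁ ρ₀ M₀ : ℝ, ∃ N₀ R₀ : ℕ, 1 ≤ B₀ ∧ 0 < c₁ ∧ ∀ (η : ℝ), 0 < η → ∀ {K : ℕ} {Ω : ℕ → Set (Site d)} (c : CubeB8 d L K Ω),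
      -- PRINT'S SIDE CONDITIONS (p. 98) on the cube datum (`M_h = Lˢ`), above threshold
      ∀ (s R : ℕ), 3 ≤ L ^ s → M₀ ≤ (L : ℝ) ^ (s + 1) → L ^ (s + 1) ∣ c.ρ → L ^ (s + 1) ∣ c.M → R * L ^ (s + 1) ≤ c.ρ → 2 * L ≤ R →
        R₀ ≤ R → N₀ + 1 ≤ R * L ^ (s + 1) → ρ₀ ≤ (c.ρ : ℝ) →
      ∀ (U₀ : Site d → Fin d → 𝔸ˣ), (∀ x κ, U₀ x κ ∈ G) → ∀ (α₀ : ℝ), 0 < α₀ → InAk L K η α₀ Ω U₀ →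
      7 * d * (L : ℝ) ^ 2 * c.M * α₀ ≤ c₁ →
      ∃ u : Site d → 𝔸ˣ, (∀ x, u x ∈ G) ∧ (∀ x, x ∉ c.sq 0 → u x = 1) ∧
        Restr129 L c.k c.lamS (1 : Site d → Fin d → 𝔸ˣ) u ∧
        IsLandau138W L c.k η (c.sq 0) c.lamS (1 : Site d → Fin d → 𝔸ˣ) (c.fixed U₀ u) ∧
        (∀ j, j ≤ c.k → ∀ b ∈ {b : Site d × Fin d | SideTouches (c.sq j) b.1 b.2},
          c.fixed U₀ u b.1 b.2 = cfgExp η (logCfg η (c.fixed U₀ u)) b.1 b.2 ∧ IsSelfAdjoint (logCfg η (c.fixed U₀ u) b.1 b.2) ∧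
            ‖logCfg η (c.fixed U₀ u) b.1 b.2‖ ≤ (7 * d * (L : ℝ) ^ 2 * (5 * (d : ℝ) * L * B₀) * c.M * α₀) * ((L : ℝ) ^ j * η)⁻¹) ∧
        (∀ x, ((c.vfix U₀)⁻¹ * u) x ∈ G) ∧
        AgreeOn (tlo L (tLo c.a c.ρ) c.k) (thi L (tHi c.a c.M c.ρ) c.k) (gaugeAct ((c.vfix U₀)⁻¹ * u)⁻¹ U₀) (c.fixed U₀ u) ∧
        msup L c.k η (-(2 : ℝ)) (fun j (t : Fin d × Fin d × Site d) => SideTouches (c.sq j) t.2.2 t.2.1)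
            (fun t => covDerivFwd η (1 : Site d → Fin d → 𝔸ˣ) t.1 (fun z => c.expo η U₀ u z t.2.1) t.2.2) ≤ (7 * d * (L : ℝ) ^ 2 * (5 * (d : ℝ) * L * B₀) * c.M * α₀) ∧
        bondNorm L c.k η (-(3 : ℝ)) c.sq
            (fun x μ => pdiv η (1 : Site d → Fin d → 𝔸ˣ) (plaqCovDeriv η (1 : Site d → Fin d → 𝔸ˣ) (c.expo η U₀ u)) μ x) ≤ (7 * d * (L : ℝ) ^ 2 * (5 * (d : ℝ) * L * B₀) * c.M * α₀) ∧
        bondNorm L c.k η (-(3 : ℝ)) c.sq (fun x μ => covLap η (1 : Site d → Fin d → 𝔸ˣ) (fun z => c.expo η U₀ u z μ) x) ≤ (7 * d * (L : ℝ) ^ 2 * (5 * (d : ℝ) * L * B₀) * c.M * α₀) ∧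
        (∀ (x : Site d) (μ : Fin d), bLo L c.a 0 0 ≤ x → x + e μ ≤ bHi L c.a c.M 0 0 →
          logCovIter L (1 : Site d → Fin d → 𝔸ˣ) (iEta η (c.expo η U₀ u)) c.k x μ = mlog ((avgIter L (c.axial U₀) c.k x μ : 𝔸ˣ) : 𝔸)) := by
  obtain ⟨d', rfl⟩ : ∃ d', d = d' + 1 := ⟨d - 1, by omega⟩
  obtain ⟨ℓ, rfl⟩ : ∃ ℓ, L = ℓ + 1 := ⟨L - 1, by omega⟩
  have hL : 2 ≤ ℓ + 1 := by omega
  have hdL : 5 ≤ (d' + 1) * (ℓ + 1) := le_trans hL5 (Nat.le_mul_of_pos_left _ (Nat.succ_pos d'))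
  exact gaugedBoundB8_cubeMember_scalar_γ_of_ineq159Printed_mem (𝔸 := 𝔸) τ hτ hd2 hL hGrp2 hGrp3 hGA hGH hGu hexpG hdL
    (ineq159FlatCubeMemberPrinted_holds d' ℓ (by omega) hodd)

#print axioms gaugedBoundB8_cubeMember_scalar_γ_holds_mem

/-! ## §4  ★★★ THE `G`-CROWN — `d ≥ 2`, odd `L ≥ 3` -/

open Classical in
/-- ★★★ **[`G`-VALUED CROWN, odd `L ≥ 3` — gauge transformation `u ∈ G`, [Balaban1985Averaging] p. 20 «a Lie subgroup G of a unitary group U(N)»]** ★★ **PROPOSITION 6 (p. 99), (1.135)–(1.138), AT EVERY CUBE OF PRINT'S BIG-BLOCK SUB-LATTICE — `d ≥ 2`, ODD `L ≥ 3`**: the `L ≥ 3` twin of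
`B8Prop6CubeMemberScalarGammaHolds.gaugedBoundB8_cubeMember_scalar_γ_holds` (statement VERBATIM with `hL5 : 5 ≤ L` replaced by `hL3 : 3 ≤ L`).  There are
`B₀ ≥ 1`, `c₁ > 0` and thresholds `ρ₀, M₀, N₀, R₀` (functions of `d, L`) such that for every `η > 0`, every cube `c : CubeB8 d L K Ω` whose datum lies on
print's p. 98 sub-lattice above threshold and every unitary `U₀ ∈ 𝔄_K({Ω_j}, α₀)` with `7dL²Mα₀ ≤ c₁`: `GaugedBoundB8 L η U₀ c (7dL²·5dLB₀·Mα₀)` — «there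
exists a gauge transformation u defined on □̃ such that U₀^{u⁻¹} = U₁ = e^{iηA} on □̃ (1.135), Lʲη|A|, (Lʲη)²|∇^η A|, (Lʲη)³|∂^{η*}∂^η A|, (Lʲη)³|Δ^η A| ≤ 7dL²B₁Mα₀
on □_j (1.136), Q_k(ηA) = (1∕i) log Ū₀′ᵏ on □^{(k)} (1.137)», Landau gauge (1.138) at background `1`.  PROOF: the γ-crown
`gaugedBoundB8_cubeMember_scalar_γ_of_ineq159Printed` (needs `2 ≤ L`, `5 ≤ d·L` — here `d·L ≥ 6`) at the `L ≥ 3` named fact `ineq159FlatCubeMemberPrinted_holds_L3 (d − 1) (L − 1)`.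
[cite: Balaban1985RegularSpaces, Prop. 6 (1.135)–(1.138) p.99, p.98, Thm 4 p.88, Prop. 3 p.87, (1.59) p.86, (1.62) p.87, (1.31) p.82; Balaban1985BackgroundPropagators, Thm 3.3 p.399, Thm 3.2 (3.48) p.398, Thm 3.1 (3.47) p.398; Balaban1984PropagatorsII, Prop. 2.6 (2.136) p.247, (2.3) p.224] -/
theorem gaugedBoundB8_cubeMember_scalar_γ_holds_L3_mem (τ : 𝔸 →L[ℂ] ℂ) (hτ : ∀ x y : 𝔸, τ (x * y) = τ (y * x)) (hd2 : 2 ≤ d) {L : ℕ} (hL3 : 3 ≤ L) (hodd : Odd L)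
    {G H : Subgroup 𝔸ˣ} (hGrp2 : ∀ g ∈ H, ‖(g : 𝔸) - 1‖ ≤ 1 / 8 → τ (mlog (g : 𝔸)) = 0) (hGrp3 : ∀ S : 𝔸, τ S = 0 → expUnit S ∈ H)
    (hGA : AvgClosed d L G) (hGH : G ≤ H) (hGu : G ≤ unitaryUnits 𝔸)
    (hexpG : ∀ lam : Site d → 𝔸, (∀ x, IsSelfAdjoint (lam x)) → (∀ x, τ (lam x) = 0) → ∀ x, gaugeExp lam x ∈ G) :
    ∃ B₀ c₁ ρ₀ M₀ : ℝ, ∃ N₀ R₀ : ℕ, 1 ≤ B₀ ∧ 0 < c₁ ∧ ∀ (η : ℝ), 0 < η → ∀ {K : ℕ} {Ω : ℕ → Set (Site d)} (c : CubeB8 d L K Ω),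
      ∀ (s R : ℕ), 3 ≤ L ^ s → M₀ ≤ (L : ℝ) ^ (s + 1) → L ^ (s + 1) ∣ c.ρ → L ^ (s + 1) ∣ c.M → R * L ^ (s + 1) ≤ c.ρ → 2 * L ≤ R →
        R₀ ≤ R → N₀ + 1 ≤ R * L ^ (s + 1) → ρ₀ ≤ (c.ρ : ℝ) →
      ∀ (U₀ : Site d → Fin d → 𝔸ˣ), (∀ x κ, U₀ x κ ∈ G) → ∀ (α₀ : ℝ), 0 < α₀ → InAk L K η α₀ Ω U₀ →
      7 * d * (L : ℝ) ^ 2 * c.M * α₀ ≤ c₁ →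
      ∃ u : Site d → 𝔸ˣ, (∀ x, u x ∈ G) ∧ (∀ x, x ∉ c.sq 0 → u x = 1) ∧
        Restr129 L c.k c.lamS (1 : Site d → Fin d → 𝔸ˣ) u ∧
        IsLandau138W L c.k η (c.sq 0) c.lamS (1 : Site d → Fin d → 𝔸ˣ) (c.fixed U₀ u) ∧
        (∀ j, j ≤ c.k → ∀ b ∈ {b : Site d × Fin d | SideTouches (c.sq j) b.1 b.2},
          c.fixed U₀ u b.1 b.2 = cfgExp η (logCfg η (c.fixed U₀ u)) b.1 b.2 ∧ IsSelfAdjoint (logCfg η (c.fixed U₀ u) b.1 b.2) ∧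
            ‖logCfg η (c.fixed U₀ u) b.1 b.2‖ ≤ (7 * d * (L : ℝ) ^ 2 * (5 * (d : ℝ) * L * B₀) * c.M * α₀) * ((L : ℝ) ^ j * η)⁻¹) ∧
        (∀ x, ((c.vfix U₀)⁻¹ * u) x ∈ G) ∧
        AgreeOn (tlo L (tLo c.a c.ρ) c.k) (thi L (tHi c.a c.M c.ρ) c.k) (gaugeAct ((c.vfix U₀)⁻¹ * u)⁻¹ U₀) (c.fixed U₀ u) ∧
        msup L c.k η (-(2 : ℝ)) (fun j (t : Fin d × Fin d × Site d) => SideTouches (c.sq j) t.2.2 t.2.1)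
            (fun t => covDerivFwd η (1 : Site d → Fin d → 𝔸ˣ) t.1 (fun z => c.expo η U₀ u z t.2.1) t.2.2) ≤ (7 * d * (L : ℝ) ^ 2 * (5 * (d : ℝ) * L * B₀) * c.M * α₀) ∧
        bondNorm L c.k η (-(3 : ℝ)) c.sq
            (fun x μ => pdiv η (1 : Site d → Fin d → 𝔸ˣ) (plaqCovDeriv η (1 : Site d → Fin d → 𝔸ˣ) (c.expo η U₀ u)) μ x) ≤ (7 * d * (L : ℝ) ^ 2 * (5 * (d : ℝ) * L * B₀) * c.M * α₀) ∧
        bondNorm L c.k η (-(3 : ℝ)) c.sq (fun x μ => covLap η (1 : Site d → Fin d → 𝔸ˣ) (fun z => c.expo η U₀ u z μ) x) ≤ (7 * d * (L : ℝ) ^ 2 * (5 * (d : ℝ) * L * B₀) * c.M * α₀) ∧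
        (∀ (x : Site d) (μ : Fin d), bLo L c.a 0 0 ≤ x → x + e μ ≤ bHi L c.a c.M 0 0 →
          logCovIter L (1 : Site d → Fin d → 𝔸ˣ) (iEta η (c.expo η U₀ u)) c.k x μ = mlog ((avgIter L (c.axial U₀) c.k x μ : 𝔸ˣ) : 𝔸)) := by
  obtain ⟨d', rfl⟩ : ∃ d', d = d' + 1 := ⟨d - 1, by omega⟩
  obtain ⟨ℓ, rfl⟩ : ∃ ℓ, L = ℓ + 1 := ⟨L - 1, by omega⟩
  have hL : 2 ≤ ℓ + 1 := by omega
  have hdL : 5 ≤ (d' + 1) * (ℓ + 1) := le_trans (by norm_num) (Nat.mul_le_mul hd2 hL3)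
  exact gaugedBoundB8_cubeMember_scalar_γ_of_ineq159Printed_mem (𝔸 := 𝔸) τ hτ hd2 hL hGrp2 hGrp3 hGA hGH hGu hexpG hdL
    (ineq159FlatCubeMemberPrinted_holds_L3 d' ℓ (by omega) hodd)

#print axioms gaugedBoundB8_cubeMember_scalar_γ_holds_L3_mem

/-! ## §5  The 3-line corollary: the body with `u ∈ G ≤ U(𝔸)` gives NODE 00's `GaugedBoundB8` -/

omit [Nontrivial 𝔸] in
/-- **THE BODY WITH A `G`-VALUED GAUGE TRANSFORMATION IMPLIES `Node00.GaugedBoundB8`** (`G ≤ U(𝔸)`; anonymous constructor, every carrier abbreviation unfolds by `rfl`):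
the unitary statement of record at NODE 00's carrier is served by name from any `G`-valued crown of this file (e.g. for ym3-torus's `HalvingP6JGaugedBoundAtMember`).
[cite: Balaban1985RegularSpaces, Prop. 6 (1.135)–(1.138) p.99, p.76; Balaban1985Averaging, p.20] -/
theorem gaugedBoundB8_of_body_mem {L K : ℕ} {Ω : ℕ → Set (Site d)} {G : Subgroup 𝔸ˣ} (hGu : G ≤ unitaryUnits 𝔸) (η : ℝ)
    (U₀ : Site d → Fin d → 𝔸ˣ) (c : CubeB8 d L K Ω) (r : ℝ)
    (h :
        ∃ u : Site d → 𝔸ˣ, (∀ x, u x ∈ G) ∧ (∀ x, x ∉ c.sq 0 → u x = 1) ∧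
          Restr129 L c.k c.lamS (1 : Site d → Fin d → 𝔸ˣ) u ∧
          IsLandau138W L c.k η (c.sq 0) c.lamS (1 : Site d → Fin d → 𝔸ˣ) (c.fixed U₀ u) ∧
          (∀ j, j ≤ c.k → ∀ b ∈ {b : Site d × Fin d | SideTouches (c.sq j) b.1 b.2},
            c.fixed U₀ u b.1 b.2 = cfgExp η (logCfg η (c.fixed U₀ u)) b.1 b.2 ∧ IsSelfAdjoint (logCfg η (c.fixed U₀ u) b.1 b.2) ∧
              ‖logCfg η (c.fixed U₀ u) b.1 b.2‖ ≤ r * ((L : ℝ) ^ j * η)⁻¹) ∧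
          (∀ x, ((c.vfix U₀)⁻¹ * u) x ∈ G) ∧
          AgreeOn (tlo L (tLo c.a c.ρ) c.k) (thi L (tHi c.a c.M c.ρ) c.k) (gaugeAct ((c.vfix U₀)⁻¹ * u)⁻¹ U₀) (c.fixed U₀ u) ∧
          msup L c.k η (-(2 : ℝ)) (fun j (t : Fin d × Fin d × Site d) => SideTouches (c.sq j) t.2.2 t.2.1)
              (fun t => covDerivFwd η (1 : Site d → Fin d → 𝔸ˣ) t.1 (fun z => c.expo η U₀ u z t.2.1) t.2.2) ≤ r ∧
          bondNorm L c.k η (-(3 : ℝ)) c.sq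
              (fun x μ => pdiv η (1 : Site d → Fin d → 𝔸ˣ) (plaqCovDeriv η (1 : Site d → Fin d → 𝔸ˣ) (c.expo η U₀ u)) μ x) ≤ r ∧
          bondNorm L c.k η (-(3 : ℝ)) c.sq (fun x μ => covLap η (1 : Site d → Fin d → 𝔸ˣ) (fun z => c.expo η U₀ u z μ) x) ≤ r ∧
          (∀ (x : Site d) (μ : Fin d), bLo L c.a 0 0 ≤ x → x + e μ ≤ bHi L c.a c.M 0 0 →
            logCovIter L (1 : Site d → Fin d → 𝔸ˣ) (iEta η (c.expo η U₀ u)) c.k x μ = mlog ((avgIter L (c.axial U₀) c.k x μ : 𝔸ˣ) : 𝔸))) :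
    GaugedBoundB8 L η U₀ c r := by
  obtain ⟨u, hu, huS, h129, h138, h162, hw, h135, h136₂, h136₃, h136₄, h137⟩ := h
  exact ⟨u, fun x => hGu (hu x), huS, h129, h138, h162, fun x => hGu (hw x), h135, h136₂, h136₃, h136₄, h137⟩

#print axioms gaugedBoundB8_of_body_mem

end Literature.MathematicalPhysics.QuantumFieldTheory.Balaban1983to89.B8Prop6CubeMemberScalarGammaHoldsG

end
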